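import Mathlib
import Summits.Ventures.PercRepro2.HCov
import Summits.Ventures.PercRepro2.BlockSubstClass
import Summits.Ventures.PercRepro2.GcSkelRules
import Summits.Ventures.PercRepro2.GcSkelReduction
import Summits.Ventures.PercRepro2.GcSkelReductionS
import Summits.Ventures.PercRepro2.GcSkelReductionC
import Summits.Ventures.PercRepro2.HubClassesAll
import Summits.Ventures.PercRepro2.GcSkelReductionR
import Summits.Ventures.PercRepro2.GcSkelReductionN

/-!
# The residual minus the block-substitution classes (blind cell PercRepro2, typer-1 g52)

mine-2 g33's block-substitution theorems (BlockSubstClass.lean, served as predicates on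
`(ends, marks)`): **`BlockSubst.FiveTerminalClass`** — the graph is a block substitution of a
loop-free, parallel-free skeleton on the five marks (every unmarked vertex inside a mark-free
two-terminal block between two marks; THEOREM 30 / the `K₅` theorem) — and
**`BlockSubst.SixTerminalClass`** — a block substitution of the 15-edge skeleton on the five marks
and one more terminal (THEOREM 32). Both are (HCOV) theorems (`HCov_of_fiveTerminalClass`,
`HCov_of_sixTerminalClass`), so they are two more clauses of the weighted residual:
**`WReducedB`** := `WReducedN` ∧ not five-terminal ∧ not six-terminal;
**`HCov_all_iff_HCovWRedB_all`**.
-/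

namespace Summit.Ventures.PercRepro2

open CovForm

namespace WRed

section ClassB

variable {V : Type*} {E : Type*} [Fintype E] [DecidableEq E] [DecidableEq V]

/-- **The residual minus the block-substitution classes**: `WReducedN`, and the instance is neither
five-terminal nor six-terminal (`BlockSubst.FiveTerminalClass` / `SixTerminalClass`). -/
structure WReducedB (ends : E → Sym2 V) (o a₁ a₂ a₃ b : V) : Prop
    extends WReducedN ends o a₁ a₂ a₃ b where
  /-- not a block substitution of a skeleton on the five marks -/
  notFive : ¬ BlockSubst.FiveTerminalClass ends o a₁ a₂ a₃ b
  /-- not a block substitution of the 15-edge skeleton on the marks and one more terminal -/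
  notSix : ¬ BlockSubst.SixTerminalClass ends o a₁ a₂ a₃ b

end ClassB

section Closure

variable (R : Type*) [Field R] [LinearOrder R] [IsStrictOrderedRing R]

/-- **(HCOV) on the residual minus the block-substitution classes**. -/
def HCovWRedB_all : Prop :=
  ∀ (V E : Type) [Fintype V] [DecidableEq V] [Fintype E] [DecidableEq E]
    (ends : E → Sym2 V) (p : E → R), IsProbVec p →
    ∀ o a₁ a₂ a₃ b : V, a₁ ≠ a₂ → a₁ ≠ a₃ → a₂ ≠ a₃ → o ≠ a₁ → o ≠ a₂ → o ≠ a₃ → o ≠ b →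
      b ≠ a₁ → b ≠ a₂ → b ≠ a₃ → WReducedB ends o a₁ a₂ a₃ b → HCov p ends o a₁ a₂ a₃ b

end Closure

section Main

variable {R : Type*} [Field R] [LinearOrder R] [IsStrictOrderedRing R]

/-- (HCOV) on `WReducedN` follows from (HCOV) on `WReducedB`: the two block-substitution classes
are theorems. -/
theorem HCovWRedN_all_of_HCovWRedB_all (hB : HCovWRedB_all R) : HCovWRedN_all R := by
  intro V E _ _ _ _ ends p hp o a₁ a₂ a₃ b h12 h13 h23 ho1 ho2 ho3 hob hb1 hb2 hb3 hred
  by_cases h5 : BlockSubst.FiveTerminalClass ends o a₁ a₂ a₃ b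
  · exact BlockSubst.HCov_of_fiveTerminalClass ends o a₁ a₂ a₃ b h5 p hp
  by_cases h6 : BlockSubst.SixTerminalClass ends o a₁ a₂ a₃ b
  · exact BlockSubst.HCov_of_sixTerminalClass ends o a₁ a₂ a₃ b h6 p hp
  exact hB V E ends p hp o a₁ a₂ a₃ b h12 h13 h23 ho1 ho2 ho3 hob hb1 hb2 hb3 ⟨hred, h5, h6⟩

/-- **THE WEIGHTED RESIDUAL MINUS THE BLOCK-SUBSTITUTION CLASSES**: (HCOV) for every finite weighted
graph with five distinct marks follows from (HCOV) on `WReducedB`. -/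
theorem HCov_all_of_HCovWRedB_all (hB : HCovWRedB_all R) : HCov_all R :=
  HCov_all_of_HCovWRedN_all (HCovWRedN_all_of_HCovWRedB_all hB)

/-- The residual minus the block-substitution classes is a faithful reduction. -/
theorem HCov_all_iff_HCovWRedB_all : HCov_all R ↔ HCovWRedB_all R :=
  ⟨fun h V E _ _ _ _ ends p hp o a₁ a₂ a₃ b h12 h13 h23 ho1 ho2 ho3 hob hb1 hb2 hb3 _ =>
    h V E ends p hp o a₁ a₂ a₃ b h12 h13 h23 ho1 ho2 ho3 hob hb1 hb2 hb3,
   HCov_all_of_HCovWRedB_all⟩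

end Main

end WRed

end Summit.Ventures.PercRepro2
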